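import Summits.BirchSwinnertonDyer.BirchSwinnertonDyer.Theses.TwoAdicConverse
import Summits.BirchSwinnertonDyer.BirchSwinnertonDyer.Theorems.GoldfeldGoodTwistsHalfHalf
import Literature.NumberTheory.EllipticCurves.BSDSelmerSmithProofs
import Literature.NumberTheory.EllipticCurves.QuadraticTwistTateFormTwoProofs
import Literature.NumberTheory.EllipticCurves.QuadraticTwistJInvariantProofs
import Literature.NumberTheory.EllipticCurves.MultiplicativeReductionBaseChangeTorsionProofs
import Literature.NumberTheory.EllipticCurves.HasseWeilAbelianConductor
import Literature.NumberTheory.EllipticCurves.CaiShuTian2014.HeegnerConditionProofs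
import Literature.NumberTheory.GaloisRepresentations.ArtinDirichletCoefficients
import HarnessLib

/-!
# Route `TwoAdicConverse` (rung S3), MULTIPLICATIVE branch: the cruxes `MultiplicativeRankZeroTwoConverse`
# (item stmt-BirchSwinnertonDyer-19219) and `RankOneTwoConverse` (19220) ⟹ Goldfeld `50 / 50` with rank
# BSD for the good quadratic twists of every non-CM curve MULTIPLICATIVE at `2`

Cell `bsd-2adic` (run/shared/lean/pub/bsd-2adic/), seat `bsd-2adic-conv-1`; the multiplicative twin of
`Theorems/TwoAdicConverseGoodTwists{,Goldfeld}.lean` (good-ordinary branch, item 19218), written so that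
the rung leaf's full hypothesis «good ordinary OR multiplicative at `2`» is covered. THEOREMS ONLY —
no named fact, no axiom, no definition; every deep input is a named fact of the tree or an OPEN route
decl / rung leaf, carried as an explicit hypothesis. (The crux 19219 itself is seat conv-2's; this file
only records its VALUE in Smith's currency and does not touch its children.)

**§0 Local lemma (PROVED, new): an unramified quadratic twist of a curve multiplicative at `2` is
multiplicative at `2`.** `hasMultiplicativeReductionAtPrime_of_smul_eq_quadraticTwist_two`: `W / ℚ`
multiplicative at `2`, `d ≡ 1 (mod 4)`, `C • W' = W^{(d)}` ⟹ `W'` multiplicative at `2`. Proof in the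
tree's Tate-normal-form currency (`QuadraticTwistTateFormTwoProofs`): `ord₂ j(W) < 0`
(`one_lt_valuation_j_of_hasMultiplicativeReduction_localMinimalModel`), so `C₀ • W = T^{(d₀)}` with
`T = tateFormOfJ j`, `d₀ ∈ ℤ`, `4 ∤ d₀` (`exists_int_variableChange_eq_quadraticTwist_tateFormOfJ`);
`d₀ ≡ 2, 3 (mod 4)` would make the conductor exponent at `2` equal to `6`, `4`
(`conductorExponent_eq_six/four_…`), contradicting `f₂ = 1` (`conductorExponent_eq_one_iff_holds`);
hence `d₀ ≡ 1 (mod 4)`, `W' ≅ T^{(d₀ d)}` (`quadraticTwist_smul`, `quadraticTwist_quadraticTwist`,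
`j(W') = j(W)`) with `d₀ d ≡ 1 (mod 4)`, and `hasMultiplicativeReductionAt_of_emod_four_eq_one`
concludes. With `j(W^{(d)}) = j(W)` the class «non-CM, multiplicative at `2`» is closed under the good
family `𝓕 = {d squarefree : d ≡ 1 (mod 4)}` (`not_hasCM_and_mult_of_smul_eq_quadraticTwist`).

**§1–§2 Value theorems** (hypotheses `hConvM` = `Theses.TwoAdicConverse.MultiplicativeRankZeroTwoConverse`
(OPEN), `hR1` = `Theses.TwoAdicConverse.RankOneTwoConverse` (OPEN residual), `hGZK`, `hpar`/Monsky,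
`hmod : exists_isNewformOf`, `hS : smith_selmerCorank_density W`), for `W` globally minimal, NON-CM,
MULTIPLICATIVE at `2`: one twist (`rankZero_bsd_…`, `rankOne_bsd_…`, `bsdRank_…`); from `hConvM`
alone the EVEN HALF OF GOLDFELD WITH BSD in `𝓕` (`tendsto_familyProportion_rankZero_mult`: exactly
`1/2` of `d ∈ 𝓕` have `ord_{s=1} L(W^{(d)}, s) = rank W^{(d)}(ℚ) = 0 ∧ Ш` finite); with `hR1` rank
BSD for `100 %` of `𝓕` (`tendsto_bsdRank_mult`) and the odd half (`tendsto_familyProportion_rankOne_mult`);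
§3 the rung-leaf form `bsdRank_and_goldfeld_goodTwists_mult_of_nonCMTwoConverse`.

HONEST FRAMING. Nothing here proves 19219, 19220, the leaf or BSD. The multiplicative `2`-converses
are open (Skinner 2016 / 2020 need `p ≥ 5`); Smith Thm. 1.1, GZK, Modularity, Monsky are named facts
taken as hypotheses. Says nothing about `d ≢ 1 (mod 4)`. PARTITION (D-0054): none — RANK axis (S3);
companion formula cell X5@2 mult (B1·O1; 1 976 book230 classes; class = every non-CM `E/ℚ`
multiplicative at `2`), owner bsd-2adic.

References: [arXiv250317619] Thm. 1.1, Cor. 1.2–1.3; [SilvermanAEC2009] VII.5.1, X.5.4; [SilvermanATAEC1994]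
IV.10.2(b), IV.11.1; [Skinner2016PacificMC]; [GreenbergLNM1716] §1; [MurtyMurty1997] Ch. 6 §1.
-/

set_option linter.dupNamespace false
set_option autoImplicit false

noncomputable section

open scoped Classical

open Filter Topology NumberField IsDedekindDomain Rat.HeightOneSpectrum WeierstrassCurve
  Literature.NumberTheory.EllipticCurves Literature.NumberTheory.EllipticCurves.ModularForms
  Literature.NumberTheory.EllipticCurves.Rank1Residual
  Summit.BirchSwinnertonDyer.BirchSwinnertonDyer.Theses.TwoAdicConverse
  Summit.BirchSwinnertonDyer.BirchSwinnertonDyer.Theorems.GoldfeldGoodTwists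

namespace Summit.BirchSwinnertonDyer.BirchSwinnertonDyer.Theorems.TwoAdicGoodTwists

/-! ## §0 Multiplicative reduction at `2` survives the good twists `d ≡ 1 (mod 4)` -/

/-- **An unramified quadratic twist of a curve multiplicative at `2` is multiplicative at `2`.** For
elliptic `W, W' / ℚ`, `d ≡ 1 (mod 4)` and `C • W' = W^{(d)}`: if `W` has multiplicative reduction at the
prime `p = 2` then so has `W'` (any models: the predicate reads a local minimal model). Stated for a
prime `p` with `p = 2` so that the place over `p` can be substituted. Proof via the Tate normal form
`T = tateFormOfJ j`: `C₀ • W = T^{(d₀)}` with `4 ∤ d₀`; `f₂(W) = 1` rules out `d₀ ≡ 2, 3 (mod 4)`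
(conductor exponents `6`, `4`), so `d₀ ≡ 1 (mod 4)` and `W' ≅ T^{(d₀ d)}` with `d₀ d ≡ 1 (mod 4)`.
[cite: SilvermanAEC2009, VII.5 Prop. 5.1(b) and X.5 Cor. 5.4.1] [cite: SilvermanATAEC1994, IV.10.2(b), IV.11.1] -/
theorem hasMultiplicativeReductionAtPrime_of_smul_eq_quadraticTwist_two
    (W W' : WeierstrassCurve ℚ) [W.IsElliptic] [W'.IsElliptic] {d : ℤ} (hd4 : d % 4 = 1)
    {C : VariableChange ℚ} (hC : C • W' = W.quadraticTwist (d : ℚ))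
    (p : ℕ) [Fact p.Prime] (hp : p = 2) (hmult : W.HasMultiplicativeReductionAtPrime p) :
    W'.HasMultiplicativeReductionAtPrime p := by
  obtain ⟨v, rfl⟩ : ∃ v : HeightOneSpectrum (𝓞 ℚ), ((primesEquiv v : ℕ)) = p :=
    ⟨primesEquiv.symm ⟨p, Fact.out⟩, by rw [Equiv.apply_symm_apply]⟩
  have hv : natGenerator v = 2 := hp
  haveI := perfectField_residueField_adicCompletionIntegers (K := ℚ) v
  have hmv : W.HasMultiplicativeReductionAt v :=
    (W.hasMultiplicativeReductionAtPrime_iff_hasMultiplicativeReductionAt_ringOfIntegers v).mp hmult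
  have hj : 1 < v.valuation ℚ W.j :=
    one_lt_valuation_j_of_hasMultiplicativeReduction_localMinimalModel v W hmv
  obtain ⟨hj0, hj1728, -⟩ := W.j_ne_and_valuation_j_sub_eq_of_one_lt_valuation_j v hj
  obtain ⟨d₀, -, hd₀4, C₀, hC₀⟩ :=
    W.exists_int_variableChange_eq_quadraticTwist_tateFormOfJ hj0 hj1728
  have hf1 : W.conductorExponent v = 1 := (conductorExponent_eq_one_iff_holds v W).mpr hmv
  have h1 : d₀ % 4 = 1 := by
    have hcases : d₀ % 4 = 1 ∨ d₀ % 4 = 2 ∨ d₀ % 4 = 3 := by omega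
    rcases hcases with h | h | h
    · exact h
    · have h6 := (conductorExponent_eq_six_of_emod_four_eq_two v hv W hj h hC₀).1; omega
    · have h4 := (conductorExponent_eq_four_of_emod_four_eq_three v hv W hj h hC₀).1; omega
  have hd0 : ((d : ℤ) : ℚ) ≠ 0 := by exact_mod_cast (show d ≠ 0 by omega)
  haveI := W.isElliptic_quadraticTwist hd0
  haveI : (C • W').IsElliptic := by rw [hC]; infer_instance
  have hjW' : W'.j = W.j := by
    rw [← W.j_quadraticTwist hd0, ← variableChange_j W' C]
    congr 1
  have hW : W = C₀⁻¹ • (tateFormOfJ W.j).quadraticTwist (d₀ : ℚ) := by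
    rw [← hC₀, inv_smul_smul]
  have h2 : W.quadraticTwist (d : ℚ) =
      (C₀⁻¹ • (tateFormOfJ W.j).quadraticTwist (d₀ : ℚ)).quadraticTwist (d : ℚ) :=
    congrArg (fun X : WeierstrassCurve ℚ => X.quadraticTwist (d : ℚ)) hW
  set C₁ : VariableChange ℚ := ⟨C₀⁻¹.u, (d : ℚ) * C₀⁻¹.r, 0, 0⟩ with hC₁
  have hC' : (C₁⁻¹ * C) • W' = (tateFormOfJ W'.j).quadraticTwist ((d₀ * d : ℤ) : ℚ) := by
    rw [mul_smul, hC, h2, quadraticTwist_smul, quadraticTwist_quadraticTwist, ← hC₁, inv_smul_smul,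
      hjW', Int.cast_mul]
  have hj' : 1 < v.valuation ℚ W'.j := by rw [hjW']; exact hj
  have hdd : (d₀ * d) % 4 = 1 := by rw [Int.mul_emod, h1, hd4]; norm_num
  exact (W'.hasMultiplicativeReductionAtPrime_iff_hasMultiplicativeReductionAt_ringOfIntegers v).mpr
    (hasMultiplicativeReductionAt_of_emod_four_eq_one v hv W' hj' hdd hC')

/-- **Good twists stay in the class «non-CM, multiplicative at `2`».** For `W / ℚ` non-CM and
multiplicative at `2`, `d ≡ 1 (mod 4)` and `C • W' = W^{(d)}`: `W'` is non-CM (`j(W') = j(W)`) and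
multiplicative at `2` (`hasMultiplicativeReductionAtPrime_of_smul_eq_quadraticTwist_two`).
[cite: SilvermanAEC2009, VII.5 Prop. 5.1(b), X.5 Cor. 5.4, App. C §11] -/
theorem not_hasCM_and_mult_of_smul_eq_quadraticTwist
    (W W' : WeierstrassCurve ℚ) [W.IsElliptic] [W'.IsElliptic] (hCM : ¬ W.HasCM) (hm : Mult W 2)
    {d : ℤ} (hd4 : d % 4 = 1) {C : VariableChange ℚ} (hC : C • W' = W.quadraticTwist (d : ℚ)) :
    ¬ W'.HasCM ∧ Mult W' 2 := by
  have hd0 : ((d : ℤ) : ℚ) ≠ 0 := by exact_mod_cast (show d ≠ 0 by omega)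
  haveI := W.isElliptic_quadraticTwist hd0
  refine ⟨fun hCM' => hCM ?_,
    hasMultiplicativeReductionAtPrime_of_smul_eq_quadraticTwist_two W W' hd4 hC 2 rfl hm⟩
  have h1 : (C • W').HasCM := hasCM_variableChange W' C hCM'
  rw [hC] at h1
  exact (hasCM_iff_of_j_eq (W.j_quadraticTwist hd0)).mp h1

/-! ## §1 One good twist -/

/-- **Rank-`0` BSD for one good twist, from the multiplicative crux.** Under
`MultiplicativeRankZeroTwoConverse` (`hConvM`, item 19219, OPEN) and `hGZK`: for `W` globally
minimal, non-CM, multiplicative at `2`, `d ≡ 1 (mod 4)` with `corank_{ℤ_2} Sel_{2^∞}(W^{(d)}) = 0`: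
`ord_{s=1} L(W^{(d)}, s) = rank W^{(d)}(ℚ) = 0` and `Ш(W^{(d)}/ℚ)` finite (transport to a minimal
model `W'` of `W^{(d)}`, which is non-CM multiplicative at `2` by §0).
[cite: arXiv250317619, §1 (the p-converse input of Cor. 1.2)] [cite: GreenbergLNM1716, §1 pp. 54–57] -/
theorem rankZero_bsd_quadraticTwist_mult_of_selmerCorankTwoInfty_eq_zero
    (hConvM : MultiplicativeRankZeroTwoConverse) (hGZK : rank_eq_analyticRank_of_analyticRank_le_one)
    (W : WeierstrassCurve ℚ) [W.IsElliptic] [W.IsGloballyMinimal] (hCM : ¬ W.HasCM) (hm : Mult W 2)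
    {d : ℤ} (hd4 : d % 4 = 1) (h0 : selmerCorankTwoInfty (W.quadraticTwist d) = 0) :
    (W.quadraticTwist d).analyticRank = 0 ∧ (W.quadraticTwist d).mordellWeilRank = 0 ∧
      Finite (W.quadraticTwist d).sha := by
  have hd0 : ((d : ℤ) : ℚ) ≠ 0 := by exact_mod_cast (show d ≠ 0 by omega)
  haveI := W.isElliptic_quadraticTwist hd0
  obtain ⟨W', hW'ell, hW'min, C, hC⟩ := exists_isGloballyMinimal_smul_eq_quadraticTwist W hd0
  obtain ⟨hCM', hm'⟩ := not_hasCM_and_mult_of_smul_eq_quadraticTwist W W' hCM hm hd4 hC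
  have hcor' : W'.selmerCorank 2 = 0 := by
    rw [selmerCorank_eq_of_variableChange 2 hC, ← selmerCorankTwoInfty_eq]; exact h0
  have har : (W.quadraticTwist (d : ℚ)).analyticRank = 0 := by
    rw [← hC, analyticRank_smul]; exact hConvM W' hCM' hm' hcor'
  obtain ⟨hrank, hsha⟩ := hGZK (W.quadraticTwist (d : ℚ)) (by omega)
  exact ⟨har, by rw [hrank, har], hsha⟩

/-- **Rank-`1` BSD for one good twist of a curve multiplicative at `2`, from the residual**
`RankOneTwoConverse` (`hR1`, item 19220, OPEN; multiplicative branch of its hypothesis).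
[cite: arXiv250317619, §1 (the p-converse input of Cor. 1.2)] [cite: GreenbergLNM1716, §1 pp. 54–57] -/
theorem rankOne_bsd_quadraticTwist_mult_of_selmerCorankTwoInfty_eq_one
    (hR1 : RankOneTwoConverse) (hGZK : rank_eq_analyticRank_of_analyticRank_le_one)
    (W : WeierstrassCurve ℚ) [W.IsElliptic] [W.IsGloballyMinimal] (hCM : ¬ W.HasCM) (hm : Mult W 2)
    {d : ℤ} (hd4 : d % 4 = 1) (h1 : selmerCorankTwoInfty (W.quadraticTwist d) = 1) :
    (W.quadraticTwist d).analyticRank = 1 ∧ (W.quadraticTwist d).mordellWeilRank = 1 ∧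
      Finite (W.quadraticTwist d).sha := by
  have hd0 : ((d : ℤ) : ℚ) ≠ 0 := by exact_mod_cast (show d ≠ 0 by omega)
  haveI := W.isElliptic_quadraticTwist hd0
  obtain ⟨W', hW'ell, hW'min, C, hC⟩ := exists_isGloballyMinimal_smul_eq_quadraticTwist W hd0
  obtain ⟨hCM', hm'⟩ := not_hasCM_and_mult_of_smul_eq_quadraticTwist W W' hCM hm hd4 hC
  have hcor' : W'.selmerCorank 2 = 1 := by
    rw [selmerCorank_eq_of_variableChange 2 hC, ← selmerCorankTwoInfty_eq]; exact h1
  have har : (W.quadraticTwist (d : ℚ)).analyticRank = 1 := by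
    rw [← hC, analyticRank_smul]; exact hR1 W' hCM' (Or.inr hm') hcor'
  obtain ⟨hrank, hsha⟩ := hGZK (W.quadraticTwist (d : ℚ)) (by omega)
  exact ⟨har, by rw [hrank, har], hsha⟩

/-- **Rank BSD for one good twist of Selmer corank `≤ 1`** (multiplicative at `2`), from
`hConvM` + `hR1` + `hGZK`. [cite: arXiv250317619, §1 (Cor. 1.2 under BSD)] -/
theorem bsdRank_quadraticTwist_mult_of_selmerCorankTwoInfty_le_one
    (hConvM : MultiplicativeRankZeroTwoConverse) (hR1 : RankOneTwoConverse)
    (hGZK : rank_eq_analyticRank_of_analyticRank_le_one)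
    (W : WeierstrassCurve ℚ) [W.IsElliptic] [W.IsGloballyMinimal] (hCM : ¬ W.HasCM) (hm : Mult W 2)
    {d : ℤ} (hd4 : d % 4 = 1) (hle : selmerCorankTwoInfty (W.quadraticTwist d) ≤ 1) :
    (W.quadraticTwist d).analyticRank = selmerCorankTwoInfty (W.quadraticTwist d) ∧
      (W.quadraticTwist d).mordellWeilRank = selmerCorankTwoInfty (W.quadraticTwist d) ∧
        Finite (W.quadraticTwist d).sha := by
  rcases Nat.le_one_iff_eq_zero_or_eq_one.mp hle with h0 | h1
  · obtain ⟨har, hrank, hsha⟩ :=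
      rankZero_bsd_quadraticTwist_mult_of_selmerCorankTwoInfty_eq_zero hConvM hGZK W hCM hm hd4 h0
    exact ⟨by rw [har, h0], by rw [hrank, h0], hsha⟩
  · obtain ⟨har, hrank, hsha⟩ :=
      rankOne_bsd_quadraticTwist_mult_of_selmerCorankTwoInfty_eq_one hR1 hGZK W hCM hm hd4 h1
    exact ⟨by rw [har, h1], by rw [hrank, h1], hsha⟩

/-- On a good twist of corank `≤ 1` of a curve multiplicative at `2`, under `hConvM` and `2`-parity:
(`r_an = 0 ∧ rank = 0 ∧ Ш` finite) ↔ `w(W^{(d)}) = +1`.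
[cite: DokchitserDokchitserAnnals2010, Thm. 1.4] [cite: arXiv250317619, Cor. 1.3] -/
theorem rankZero_bsd_iff_rootNumber_eq_one_mult_of_selmerCorankTwoInfty_le_one
    (hConvM : MultiplicativeRankZeroTwoConverse) (hGZK : rank_eq_analyticRank_of_analyticRank_le_one)
    (hpar : ∀ (E : WeierstrassCurve ℚ) [E.IsElliptic], p_parity E 2)
    (W : WeierstrassCurve ℚ) [W.IsElliptic] [W.IsGloballyMinimal] (hCM : ¬ W.HasCM) (hm : Mult W 2)
    {d : ℤ} (hd4 : d % 4 = 1) (hle : selmerCorankTwoInfty (W.quadraticTwist d) ≤ 1) :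
    ((W.quadraticTwist d).analyticRank = 0 ∧ (W.quadraticTwist d).mordellWeilRank = 0 ∧
        Finite (W.quadraticTwist d).sha) ↔ (W.quadraticTwist d).rootNumber = 1 := by
  have hd0 : ((d : ℤ) : ℚ) ≠ 0 := by exact_mod_cast (show d ≠ 0 by omega)
  haveI := W.isElliptic_quadraticTwist hd0
  have h2 : (-1 : ℤ) ^ (W.quadraticTwist (d : ℚ)).selmerCorank 2 =
      (W.quadraticTwist (d : ℚ)).rootNumber := hpar _
  rw [← selmerCorankTwoInfty_eq] at h2
  constructor
  · rintro ⟨-, hrank, hsha⟩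
    haveI := hsha
    have hc : selmerCorankTwoInfty (W.quadraticTwist (d : ℚ)) = 0 := by
      rw [selmerCorankTwoInfty_eq,
        selmerCorank_eq_mordellWeilRank_of_finite_shaPrimary _ 2 inferInstance, hrank]
    rw [hc] at h2
    simpa using h2.symm
  · intro hw
    rw [hw] at h2
    have hc1 : selmerCorankTwoInfty (W.quadraticTwist (d : ℚ)) ≠ 1 := fun h1 ↦ by
      rw [h1] at h2
      norm_num at h2
    exact rankZero_bsd_quadraticTwist_mult_of_selmerCorankTwoInfty_eq_zero hConvM hGZK W hCM hm hd4
      (by omega)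

/-! ## §2 Densities in the good family `𝓕` -/

section Density

variable (W : WeierstrassCurve ℚ) [W.IsElliptic] [W.IsGloballyMinimal]

/-- **THE EVEN HALF OF GOLDFELD, WITH BSD, IN `𝓕` — from the multiplicative crux alone.** For `W`
globally minimal, NON-CM, MULTIPLICATIVE at `2`, under `hConvM` (item 19219), `hGZK`, `2`-parity
(`hpar`), Modularity (`hmod`) and Smith's Thm. 1.1 for `W` (`hS`): among `d ∈ 𝓕`, `|d| ≤ X`, the
proportion with `ord_{s=1} L(W^{(d)}, s) = rank W^{(d)}(ℚ) = 0 ∧ Ш(W^{(d)}/ℚ)` finite tends to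
EXACTLY `1/2`. [cite: arXiv250317619, Thm. 1.1 and Cor. 1.2] [cite: MurtyMurty1997, Ch. 6 §1]
[cite: DokchitserDokchitserAnnals2010, Thm. 1.4] -/
theorem tendsto_familyProportion_rankZero_mult
    (hConvM : MultiplicativeRankZeroTwoConverse) (hGZK : rank_eq_analyticRank_of_analyticRank_le_one)
    (hpar : ∀ (E : WeierstrassCurve ℚ) [E.IsElliptic], p_parity E 2) (hmod : exists_isNewformOf)
    (hCM : ¬ W.HasCM) (hm : Mult W 2) (hS : smith_selmerCorank_density W) :
    Tendsto (fun X : ℕ ↦ (Nat.card {d : ℤ | Squarefree d ∧ |d| ≤ (X : ℤ) ∧ (d % 4 = 1 ∧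
        ((W.quadraticTwist d).analyticRank = 0 ∧ (W.quadraticTwist d).mordellWeilRank = 0 ∧
          Finite (W.quadraticTwist d).sha))} : ℝ) /
      Nat.card {d : ℤ | Squarefree d ∧ |d| ≤ (X : ℤ) ∧ d % 4 = 1}) atTop (𝓝 (1 / 2)) := by
  have hR := twistDensity_selmerCorankTwoInfty_le_one_of W hS
  have h0 : twistDensity (fun d ↦ ¬ (d ≠ 0 ∧ selmerCorankTwoInfty (W.quadraticTwist d) ≤ 1)) 0 := by
    simpa using hR.compl
  have hRF : Tendsto (fun X : ℕ ↦ (Nat.card {d : ℤ | Squarefree d ∧ |d| ≤ (X : ℤ) ∧ (d % 4 = 1 ∧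
        (d ≠ 0 ∧ selmerCorankTwoInfty (W.quadraticTwist d) ≤ 1))} : ℝ) /
      Nat.card {d : ℤ | Squarefree d ∧ |d| ≤ (X : ℤ) ∧ d % 4 = 1}) atTop (𝓝 1) :=
    tendsto_familyProportion_one_of_twistDensity_zero (h0.mono_zero fun d _ h hRd ↦ h.2 hRd)
  refine tendsto_familyProportion_of_congr_one (tendsto_familyProportion_rootNumber_eq_one W hmod)
    hRF fun d _ hd4 hRd ↦ ?_
  exact (rankZero_bsd_iff_rootNumber_eq_one_mult_of_selmerCorankTwoInfty_le_one hConvM hGZK hpar W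
    hCM hm hd4 hRd.2).symm

/-- The same with `2`-parity from Monsky's congruence and Modularity.
[cite: arXiv250317619, Thm. 1.1 and Cor. 1.2] [cite: DokchitserDokchitserAnnals2010, §4.6 (case p = 2)] -/
theorem tendsto_familyProportion_rankZero_mult_of_monsky
    (hConvM : MultiplicativeRankZeroTwoConverse) (hGZK : rank_eq_analyticRank_of_analyticRank_le_one)
    (hmod : exists_isNewformOf) (hMon : monsky_selmerCorank_two_mod_two_eq)
    (hCM : ¬ W.HasCM) (hm : Mult W 2) (hS : smith_selmerCorank_density W) :
    Tendsto (fun X : ℕ ↦ (Nat.card {d : ℤ | Squarefree d ∧ |d| ≤ (X : ℤ) ∧ (d % 4 = 1 ∧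
        ((W.quadraticTwist d).analyticRank = 0 ∧ (W.quadraticTwist d).mordellWeilRank = 0 ∧
          Finite (W.quadraticTwist d).sha))} : ℝ) /
      Nat.card {d : ℤ | Squarefree d ∧ |d| ≤ (X : ℤ) ∧ d % 4 = 1}) atTop (𝓝 (1 / 2)) :=
  tendsto_familyProportion_rankZero_mult W hConvM hGZK
    (fun E _ ↦ p_parity_of_selmerCorank_mod_two_eq_of_exists_isNewformOf E 2 hmod (hMon.apply E))
    hmod hCM hm hS

/-- **Rank BSD for `100 %` of the good twists of a non-CM curve multiplicative at `2`**, from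
`hConvM` + `hR1`: for `d ∈ 𝓕` of relative density `1`,
`ord_{s=1} L(W^{(d)}, s) = rank W^{(d)}(ℚ) = corank_{ℤ_2} Sel_{2^∞}(W^{(d)}) ≤ 1` and `Ш` finite.
[cite: arXiv250317619, Thm. 1.1 and Cor. 1.2] -/
theorem tendsto_bsdRank_eq_selmerCorankTwoInfty_mult
    (hConvM : MultiplicativeRankZeroTwoConverse) (hR1 : RankOneTwoConverse)
    (hGZK : rank_eq_analyticRank_of_analyticRank_le_one)
    (hCM : ¬ W.HasCM) (hm : Mult W 2) (hS : smith_selmerCorank_density W) :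
    Tendsto (fun X : ℕ ↦ (Nat.card {d : ℤ | Squarefree d ∧ |d| ≤ (X : ℤ) ∧ (d % 4 = 1 ∧
        (selmerCorankTwoInfty (W.quadraticTwist d) ≤ 1 ∧
          (W.quadraticTwist d).analyticRank = selmerCorankTwoInfty (W.quadraticTwist d) ∧
          (W.quadraticTwist d).mordellWeilRank = selmerCorankTwoInfty (W.quadraticTwist d) ∧
          Finite (W.quadraticTwist d).sha))} : ℝ) /
      Nat.card {d : ℤ | Squarefree d ∧ |d| ≤ (X : ℤ) ∧ d % 4 = 1}) atTop (𝓝 1) := by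
  have hR := twistDensity_selmerCorankTwoInfty_le_one_of W hS
  have h0 : twistDensity (fun d ↦ ¬ (d ≠ 0 ∧ selmerCorankTwoInfty (W.quadraticTwist d) ≤ 1)) 0 := by
    simpa using hR.compl
  refine tendsto_familyProportion_one_of_twistDensity_zero (h0.mono_zero fun d _ h hRd ↦ h.2 ?_)
  exact ⟨hRd.2, bsdRank_quadraticTwist_mult_of_selmerCorankTwoInfty_le_one hConvM hR1 hGZK W hCM hm
    h.1 hRd.2⟩

/-- The headline shape (multiplicative at `2`): for `100 %` of `d ∈ 𝓕`,
`ord_{s=1} L(W^{(d)}, s) = rank W^{(d)}(ℚ)` and `Ш(W^{(d)}/ℚ)` is finite. [cite: arXiv250317619, Thm. 1.1 and Cor. 1.2] -/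
theorem tendsto_bsdRank_mult
    (hConvM : MultiplicativeRankZeroTwoConverse) (hR1 : RankOneTwoConverse)
    (hGZK : rank_eq_analyticRank_of_analyticRank_le_one)
    (hCM : ¬ W.HasCM) (hm : Mult W 2) (hS : smith_selmerCorank_density W) :
    Tendsto (fun X : ℕ ↦ (Nat.card {d : ℤ | Squarefree d ∧ |d| ≤ (X : ℤ) ∧ (d % 4 = 1 ∧
        ((W.quadraticTwist d).analyticRank = (W.quadraticTwist d).mordellWeilRank ∧
          Finite (W.quadraticTwist d).sha))} : ℝ) /
      Nat.card {d : ℤ | Squarefree d ∧ |d| ≤ (X : ℤ) ∧ d % 4 = 1}) atTop (𝓝 1) := by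
  have hR := twistDensity_selmerCorankTwoInfty_le_one_of W hS
  have h0 : twistDensity (fun d ↦ ¬ (d ≠ 0 ∧ selmerCorankTwoInfty (W.quadraticTwist d) ≤ 1)) 0 := by
    simpa using hR.compl
  refine tendsto_familyProportion_one_of_twistDensity_zero (h0.mono_zero fun d _ h hRd ↦ h.2 ?_)
  obtain ⟨har, hrank, hsha⟩ :=
    bsdRank_quadraticTwist_mult_of_selmerCorankTwoInfty_le_one hConvM hR1 hGZK W hCM hm h.1 hRd.2
  exact ⟨har.trans hrank.symm, hsha⟩

/-- **Goldfeld, even half, in `𝓕` (multiplicative at `2`) via the functional equation**, from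
`hConvM` + `hR1` + `hGZK` + Modularity + Smith. [cite: arXiv250317619, Thm. 1.1 and Cor. 1.2]
[cite: MurtyMurty1997, Ch. 6 §1] -/
theorem tendsto_familyProportion_rankZero_mult_of_residual
    (hConvM : MultiplicativeRankZeroTwoConverse) (hR1 : RankOneTwoConverse)
    (hGZK : rank_eq_analyticRank_of_analyticRank_le_one) (hmod : exists_isNewformOf)
    (hCM : ¬ W.HasCM) (hm : Mult W 2) (hS : smith_selmerCorank_density W) :
    Tendsto (fun X : ℕ ↦ (Nat.card {d : ℤ | Squarefree d ∧ |d| ≤ (X : ℤ) ∧ (d % 4 = 1 ∧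
        ((W.quadraticTwist d).analyticRank = 0 ∧ (W.quadraticTwist d).mordellWeilRank = 0 ∧
          Finite (W.quadraticTwist d).sha))} : ℝ) /
      Nat.card {d : ℤ | Squarefree d ∧ |d| ≤ (X : ℤ) ∧ d % 4 = 1}) atTop (𝓝 (1 / 2)) := by
  refine tendsto_familyProportion_of_congr_one (tendsto_familyProportion_rootNumber_eq_one W hmod)
    (tendsto_bsdRank_eq_selmerCorankTwoInfty_mult W hConvM hR1 hGZK hCM hm hS)
    fun d hd _ hR ↦ ?_
  obtain ⟨hle, hra, hrk, hsha⟩ := hR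
  haveI := W.isElliptic_quadraticTwist (d := (d : ℚ)) (by exact_mod_cast hd.ne_zero)
  rw [rootNumber_eq_one_iff_analyticRank_eq_zero hmod _ (hra ▸ hle)]
  constructor
  · intro h0; exact ⟨h0, by rw [hrk, ← hra, h0], hsha⟩
  · exact fun h ↦ h.1

/-- **Goldfeld, odd half, in `𝓕` (multiplicative at `2`)**, from `hConvM` + `hR1` + `hGZK` +
Modularity + Smith. [cite: arXiv250317619, Thm. 1.1 and Cor. 1.2] [cite: MurtyMurty1997, Ch. 6 §1] -/
theorem tendsto_familyProportion_rankOne_mult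
    (hConvM : MultiplicativeRankZeroTwoConverse) (hR1 : RankOneTwoConverse)
    (hGZK : rank_eq_analyticRank_of_analyticRank_le_one) (hmod : exists_isNewformOf)
    (hCM : ¬ W.HasCM) (hm : Mult W 2) (hS : smith_selmerCorank_density W) :
    Tendsto (fun X : ℕ ↦ (Nat.card {d : ℤ | Squarefree d ∧ |d| ≤ (X : ℤ) ∧ (d % 4 = 1 ∧
        ((W.quadraticTwist d).analyticRank = 1 ∧ (W.quadraticTwist d).mordellWeilRank = 1 ∧
          Finite (W.quadraticTwist d).sha))} : ℝ) /
      Nat.card {d : ℤ | Squarefree d ∧ |d| ≤ (X : ℤ) ∧ d % 4 = 1}) atTop (𝓝 (1 / 2)) := by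
  refine tendsto_familyProportion_of_congr_one
    (tendsto_familyProportion_rootNumber_eq_neg_one W hmod)
    (tendsto_bsdRank_eq_selmerCorankTwoInfty_mult W hConvM hR1 hGZK hCM hm hS)
    fun d hd _ hR ↦ ?_
  obtain ⟨hle, hra, hrk, hsha⟩ := hR
  haveI := W.isElliptic_quadraticTwist (d := (d : ℚ)) (by exact_mod_cast hd.ne_zero)
  rw [rootNumber_eq_neg_one_iff_analyticRank_eq_one hmod _ (hra ▸ hle)]
  constructor
  · intro h1; exact ⟨h1, by rw [hrk, ← hra, h1], hsha⟩
  · exact fun h ↦ h.1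

end Density

/-! ## §3 From the rung leaf S3 (multiplicative branch) -/

section FromLeaf

variable (W : WeierstrassCurve ℚ) [W.IsElliptic] [W.IsGloballyMinimal]

/-- **The rung's head line on the multiplicative branch.** The leaf `Rank1Residual.NonCMTwoConverse`,
Gross–Zagier–Kolyvagin, Modularity and Smith's Thm. 1.1 for `W` give, for every globally minimal
NON-CM `W / ℚ` MULTIPLICATIVE at `2`: rank BSD for `100 %` of the good twists `d ∈ 𝓕` and Goldfeld's
`50 / 50`. [cite: arXiv250317619, Thm. 1.1 and Cor. 1.2] [cite: MurtyMurty1997, Ch. 6 §1] -/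
theorem bsdRank_and_goldfeld_goodTwists_mult_of_nonCMTwoConverse
    (hS3 : Summit.BirchSwinnertonDyer.BirchSwinnertonDyer.Rank1Residual.NonCMTwoConverse)
    (hGZK : rank_eq_analyticRank_of_analyticRank_le_one) (hmod : exists_isNewformOf)
    (hCM : ¬ W.HasCM) (hm : Mult W 2) (hS : smith_selmerCorank_density W) :
    Tendsto (fun X : ℕ ↦ (Nat.card {d : ℤ | Squarefree d ∧ |d| ≤ (X : ℤ) ∧ (d % 4 = 1 ∧
        ((W.quadraticTwist d).analyticRank = (W.quadraticTwist d).mordellWeilRank ∧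
          Finite (W.quadraticTwist d).sha))} : ℝ) /
      Nat.card {d : ℤ | Squarefree d ∧ |d| ≤ (X : ℤ) ∧ d % 4 = 1}) atTop (𝓝 1) ∧
    Tendsto (fun X : ℕ ↦ (Nat.card {d : ℤ | Squarefree d ∧ |d| ≤ (X : ℤ) ∧ (d % 4 = 1 ∧
        ((W.quadraticTwist d).analyticRank = 0 ∧ (W.quadraticTwist d).mordellWeilRank = 0 ∧
          Finite (W.quadraticTwist d).sha))} : ℝ) /
      Nat.card {d : ℤ | Squarefree d ∧ |d| ≤ (X : ℤ) ∧ d % 4 = 1}) atTop (𝓝 (1 / 2)) ∧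
    Tendsto (fun X : ℕ ↦ (Nat.card {d : ℤ | Squarefree d ∧ |d| ≤ (X : ℤ) ∧ (d % 4 = 1 ∧
        ((W.quadraticTwist d).analyticRank = 1 ∧ (W.quadraticTwist d).mordellWeilRank = 1 ∧
          Finite (W.quadraticTwist d).sha))} : ℝ) /
      Nat.card {d : ℤ | Squarefree d ∧ |d| ≤ (X : ℤ) ∧ d % 4 = 1}) atTop (𝓝 (1 / 2)) := by
  have hConvM : MultiplicativeRankZeroTwoConverse :=
    fun V _ _ hcm hm' h0 ↦ hS3 V hcm (Or.inr hm') 0 (Nat.zero_le 1) h0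
  have hR1 : RankOneTwoConverse := fun V _ _ hcm hred h1 ↦ hS3 V hcm hred 1 le_rfl h1
  exact ⟨tendsto_bsdRank_mult W hConvM hR1 hGZK hCM hm hS,
    tendsto_familyProportion_rankZero_mult_of_residual W hConvM hR1 hGZK hmod hCM hm hS,
    tendsto_familyProportion_rankOne_mult W hConvM hR1 hGZK hmod hCM hm hS⟩

end FromLeaf

end Summit.BirchSwinnertonDyer.BirchSwinnertonDyer.Theorems.TwoAdicGoodTwists

end
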